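import Mathlib
import HarnessLib
import Summits.Langlands.Langlands.Theses.KleinTorsionDoor

/-!
# Birth skeleton (BC3) for crux stmt-Langlands-14193
`Summit.Langlands.Langlands.Theses.KleinTorsionDoor.SeptadicTorsionOccurrence` — line `birth`

Route `route-Langlands-KleinTorsionDoor` (rank-2 crux α).  The crux says: for an odd Klein-image
`σ : Γ_ℚ → GL₃(ℂ)` and `ι : ℚ̄₇ ≃ ℂ`, RESIDUAL occurrence of the eigensystem of `ι⁻¹σ` in some
`H^i(Γ₁(N) ⊂ SL₃(ℤ), 𝔽̄₇)` (the Door's conclusion, eigenvector sense) implies occurrence MOD `7^s` for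
EVERY `s ≥ 1`: a point of the Hecke algebra of some `H^{i_s}(Γ₁(N_s), 𝒪/7^s)` (every non-commutative
relation among the `T(ℓ,k)`, `ℓ ∤ N_s`, `k ≤ 3`, and the diamond operators `⟨d⟩` is killed by the
values) with the Frobenius congruences `≤ 7^{-s}`.  Informally: `σ ∈ Spf 𝕋(Kᵖ)_𝔪`, the output of
big `R_σ̄ = 𝕋_𝔪` for completed cohomology of `GL₃/ℚ` read on the `𝒪`-point `x_σ`.

The skeleton cuts the crux along the mechanism the route names (its two-layer plan
`BigRTKleinSeven → FiniteLevelReadout → α`; the plan's first node `TangentAtSeven` is the `s = 1`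
CONSEQUENCE / cheapest falsifier, not a proof step, and is deliberately not a stub):

* `stub_liftsAreSpfPoints` — **big `R_σ̄ = 𝕋_𝔪` on `ℚ̄₇`-points (the engine; open).**  Under the crux
  hypotheses (Klein image, odd, the Door's residual data `(N, i, ā, ε̄)`): EVERY continuous
  `ρ : Γ_ℚ → GL₃(ℚ̄₇)` which is unramified at the places prime to `N` and whose Frobenius polynomials
  are congruent modulo `𝔪_{ℚ̄₇}` to the Door's residual eigensystem (so `ρ̄ ≅ σ̄ ≅ Ad⁰ρ̄_g`,
  absolutely irreducible) is an `𝒪`-VALUED POINT OF THE BIG `7`-ADIC HECKE ALGEBRA of some tame level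
  `N₀`, `N ∣ N₀`: there are `7`-adic integers `A(ℓ,k)` (uniform in the depth `s`), a
  "nebentype on primes" `η` with inverse `θ`, such that (a) EXACTLY `charpoly ρ(Frob_ℓ) = X³ − A(ℓ,1)X²
  + ℓA(ℓ,2)X − ℓ³η(ℓ)` for `ℓ ∤ 7N₀` (arithmetic Frobenius, the crux's normalisation), and (b) for
  every depth `s ≥ 1` there are a level `Γ₁(N₀·7^r)`, `r ≥ s`, and a degree `i` at which `T(ℓ,k) ↦ A(ℓ,k)`,
  `T_{D(q)} ↦ θ(q)A(q,1)` kills every relation among the operators `T(ℓ,k)` and `T_{D(q)}` on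
  `H^i(Γ₁(N₀7^r), 𝒪/7^s)`, where `D(q) = diag(1,1,q) ∈ GL₃(ℚ)` (`q ∤ 7N₀` prime) is the MIRABOLIC
  Hecke element: its double-coset operator is `T(q,1)∘⟨q⟩⁻¹` at every level `Γ₁(M)`, `q ∤ M`
  (same determinant `q`, elementary divisors `(1,1,q)` and last row `≡ (0,0,q)` as
  `E(q,1)·γ_{q⁻¹}⁻¹`; tree conventions `T_g f(xΓ) = ∑_{hΓ ⊆ ΓgΓ} f(xhΓ)`, `⟨d⟩ = T_{γ_d⁻¹}`), so that,
  unlike `⟨d⟩` itself (whose representative `γ_d ∈ Γ₀(N₀7^r)` changes with `r`), the family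
  `{T(ℓ,k), T_{D(q)}}` is ONE family of rational Hecke elements acting on the whole `7`-power tower —
  the honest finite-level form of "`ρ` is a point of `𝕋(Kᵖ) = lim_{r,s} 𝕋(Γ₁(N₀7^r), 𝒪/7^s)`".
  This is strictly MORE than the crux (all `7`-adic lifts of `σ̄`, not only `ι⁻¹σ`: the content of
  `R_σ̄,S ↠ 𝕋_𝔪` having nilpotent kernel, Calegari–Geraghty / Gee–Newton patching in defect
  `l₀ = 1`, at the non-adequate prime `7`: `H¹(PSL₂(𝔽₇), ad⁰) ≠ 0`), and it is where the crux's
  `why it might fail` lives.  Size XL / open problem.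
* `stub_mirabolicReadout` — **from the Spf-point to the crux's single-piece torsion occurrence with
  diamonds (the readout; provable in principle, L).**  For odd Klein `σ`: if `ι⁻¹σ` is an `𝒪`-point of
  the mirabolic big Hecke algebra as above (exact identities, `T ⊕ D` family), then the crux's
  conclusion holds: at level `N_s := N₀·7^r` the values extend to the algebra generated by the
  `T(ℓ,k)` AND the diamond operators `⟨d⟩`, `d ∈ (ℤ/N_s)ˣ`, with `ε ≡ η` and the congruences
  `≤ 7^{-s}` (indeed equalities).  Mechanism: the operators commute; localise the finite-level Hecke
  algebra at the maximal ideal `𝔫` under the point; for every class `d mod N_s` Chebotarev in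
  `K(ζ_{N_s})/ℚ` (`K` the Klein field; `K ∩ ℚ(ζ_∞) = ℚ` because `Gal(K/ℚ) ≅ GL₃(𝔽₂)` is simple
  non-abelian — this is where the Klein hypothesis is used) gives a prime `q ≡ d` with
  `σ(Frob_q) = 1`, so `A(q,1) = 3 ∈ 𝒪ˣ`, `T(q,1)` is a unit at `𝔫` and `⟨q⟩ = T_{D(q)}⁻¹ T(q,1)` lies in
  the localised `T ⊕ D` algebra; hence the point extends (uniquely) to the diamonds, `ε(q) = η(q)`,
  and two characters of `(ℤ/N_s)ˣ` agreeing on such primes agree (`r ≥ s` makes `η mod 7^s` a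
  character of `(ℤ/N₀7^r)ˣ`).  The refuter's flags F-a/F-b on the crux (torsion newvectors at `7`,
  single `(N,i,s)` reading) are located here and in (b) of the first stub respectively.
* `SeptadicTorsionOccurrence_of` — **the composition, kernel-checked (no `sorry`)**, with REAL content:
  the `7`-adic avatar `ρ_σ := ι⁻¹ ∘ σ : Γ_ℚ → GL₃(ℚ̄₇)` is constructed here (`exists_sevenAdicAvatar`:
  continuity because `ker σ` is closed of finite index — the Klein image is finite — hence open;
  Frobenius polynomials transported by `Matrix.charpoly_map`, unramifiedness by `map_one`), the first
  stub is applied to `ρ_σ` (residually congruent to the Door data because `σ` is), its exact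
  identities are pulled back to `σ` along `ι`, and the second stub returns the crux BY NAME.

Conventions risk, declared: the value `θ(q)A(q,1)` on `T_{D(q)}` encodes `T_{D(q)} = T(q,1)⟨q⟩⁻¹`
(derived from the tree's documented dictionary `T_g = τ_{g⁻¹}`, `⟨d⟩ = τ_{γ_d}`); should the
double-coset bookkeeping give `T(q,1)⟨q⟩` instead, the repair is the one-token swap `θ ↦ η` in both
stubs (a `misstated`-class repair, not a kill of the line).

Disproof used: none on file for this crux (`ledger crux ls stmt-Langlands-14193`: no workfiles, no
`Disproof.lean`, no `Negative/` lemmas, 2026-08-17).  Refuter evidence read: crux-attack SURVIVES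
(2026-08-15; flags F-a, F-b, F-d recorded above / in the line card).

Shape (for `ledger skeleton check` / `#h21_check_skeleton`): stubs `theorem stub_<name> : <signature> := by
sorry` stated over tree declarations only (`FramedGaloisRep`, `TorsionHeckeEigensystem.Occurs`,
`SLn.heckeT / heckeOp / diamondOp / Gamma1 / diagGL / natUnit`, `PadicAlgCl`, Mathlib `FreeAlgebra.lift`);
`_Goal.stub_<name> : Prop := type_of% @stub_<name>` names each statement; the composition
`SeptadicTorsionOccurrence_of (hA : _Goal.stub_liftsAreSpfPoints) (hB : _Goal.stub_mirabolicReadout) :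
SeptadicTorsionOccurrence` is proved without `sorry`.
-/

set_option linter.dupNamespace false
set_option linter.unusedVariables false

noncomputable section

namespace Summit.Langlands.Langlands.Cruxes.SeptadicTorsionOccurrence.Birth

open Summit.Langlands.Langlands.Theses.KleinTorsionDoor
open Literature.NumberTheory.Automorphic Literature.NumberTheory.GaloisRepresentations
open NumberField IsDedekindDomain

/-! ## 0. Vocabulary (verbatim pieces of the crux; `septadicTorsionOccurrence_iff` is `Iff.rfl`) -/

/-- **The Door data** (the crux's hypothesis): residual occurrence of the eigensystem of `ι⁻¹σ` in some
`H^i(Γ₁(N) ⊂ SL₃(ℤ), 𝔽̄₇)`, `N > 0`, in Ash's eigenvector sense, with the three coefficientwise Frobenius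
congruences modulo `𝔪_{ℚ̄₇}` and unramifiedness at every `v` prime to `N` — verbatim from the route
decl. [folklore] -/
def DoorData [Fact (Nat.Prime 7)] (ι : PadicAlgCl 7 ≃+* ℂ) (σ : FramedGaloisRep ℚ ℂ 3) : Prop :=
  ∃ (N i : ℕ) (a : ℕ → ℕ → ↥(Valued.v (R := PadicAlgCl 7)).valuationSubring) (ε : (ZMod N)ˣ → ↥(Valued.v (R := PadicAlgCl 7)).valuationSubring), 0 < N ∧ Literature.NumberTheory.Automorphic.TorsionHeckeEigensystem.Occurs 3 N (IsLocalRing.ResidueField ↥(Valued.v (R := PadicAlgCl 7)).valuationSubring) i ∅ (fun ℓ k => IsLocalRing.residue ↥(Valued.v (R := PadicAlgCl 7)).valuationSubring (a ℓ k)) (fun d => IsLocalRing.residue ↥(Valued.v (R := PadicAlgCl 7)).valuationSubring (ε d)) ∧ (∀ (v : IsDedekindDomain.HeightOneSpectrum (NumberField.RingOfIntegers ℚ)) (hv : Nat.Coprime v.residueCard N), σ.IsUnramifiedAt v ∧ ∀ P : Polynomial ℂ, σ.HasFrobCharpolyAt v P → ‖(P.map (ι.symm : ℂ →+* PadicAlgCl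 7)).coeff 2 + (a v.residueCard 1 : PadicAlgCl 7)‖ < 1 ∧ ‖(P.map (ι.symm : ℂ →+* PadicAlgCl 7)).coeff 1 - (v.residueCard : PadicAlgCl 7) * (a v.residueCard 2 : PadicAlgCl 7)‖ < 1 ∧ ‖(P.map (ι.symm : ℂ →+* PadicAlgCl 7)).coeff 0 + (v.residueCard : PadicAlgCl 7) ^ 3 * (ε (ZMod.unitOfCoprime v.residueCard hv) : PadicAlgCl 7)‖ < 1)

/-- **The crux's conclusion**: occurrence modulo `7^s` for every `s ≥ 1` in the Hecke-ALGEBRA sense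
(every relation among the `T(ℓ,k)`, `ℓ ∤ N_s` prime, `k ≤ 3`, and the `⟨d⟩` on `H^{i_s}(Γ₁(N_s), 𝒪/7^s)`
is killed by the values) with the Frobenius congruences `≤ 7^{-s}` — verbatim from the route decl.
[folklore] -/
def CruxConclusion [Fact (Nat.Prime 7)] (ι : PadicAlgCl 7 ≃+* ℂ) (σ : FramedGaloisRep ℚ ℂ 3) : Prop :=
  ∀ s : ℕ, 1 ≤ s → ∃ (N i : ℕ) (a : ℕ → ℕ → ↥(Valued.v (R := PadicAlgCl 7)).valuationSubring) (ε : (ZMod N)ˣ → ↥(Valued.v (R := PadicAlgCl 7)).valuationSubring), 0 < N ∧ (∀ F : FreeAlgebra (↥(Valued.v (R := PadicAlgCl 7)).valuationSubring ⧸ Ideal.span {((7 : ↥(Valued.v (R := PadicAlgCl 7)).valuationSubring) ^ s)}) ({lk : ℕ × ℕ // Nat.Prime lk.1 ∧ ¬ lk.1 ∣ N ∧ lk.2 ≤ 3} ⊕ (ZMod N)ˣ), FreeAlgebra.lift (↥(Valued.v (R := PadicAlgCl 7)).valuationSubring ⧸ Ideal.span {((7 : ↥(Valued.v (R := PadicAlgCl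 7)).valuationSubring) ^ s)}) (Sum.elim (fun lk : {lk : ℕ × ℕ // Nat.Prime lk.1 ∧ ¬ lk.1 ∣ N ∧ lk.2 ≤ 3} => Literature.NumberTheory.Automorphic.SLn.heckeT 3 (Literature.NumberTheory.Automorphic.SLn.Gamma1 3 N) (↥(Valued.v (R := PadicAlgCl 7)).valuationSubring ⧸ Ideal.span {((7 : ↥(Valued.v (R := PadicAlgCl 7)).valuationSubring) ^ s)}) i lk.1.1 lk.1.2) (fun d : (ZMod N)ˣ => Literature.NumberTheory.Automorphic.SLn.diamondOp 3 N (↥(Valued.v (R := PadicAlgCl 7)).valuationSubring ⧸ Ideal.span {((7 : ↥(Valued.v (R := PadicAlgCl 7)).valuationSubring) ^ s)}) i (d : ZMod N))) F = 0 → FreeAlgebra.lift (↥(Valued.v (R := PadicAlgCl 7)).valuationSubring ⧸ Ideal.span {((7 : ↥(Valued.v (R := PadicAlgCl 7)).valuationSubring) ^ s)}) (Sum.elim (fun lk : {lk : ℕ × ℕ // Nat.Prime lk.1 ∧ ¬ lk.1 ∣ N ∧ lk.2 ≤ 3} => Ideal.Quotient.mk (Ideal.span {((7 : ↥(Valued.v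 (R := PadicAlgCl 7)).valuationSubring) ^ s)}) (a lk.1.1 lk.1.2)) (fun d : (ZMod N)ˣ => Ideal.Quotient.mk (Ideal.span {((7 : ↥(Valued.v (R := PadicAlgCl 7)).valuationSubring) ^ s)}) (ε d))) F = 0) ∧ ∀ (v : IsDedekindDomain.HeightOneSpectrum (NumberField.RingOfIntegers ℚ)) (hv : Nat.Coprime v.residueCard N), σ.IsUnramifiedAt v ∧ ∀ P : Polynomial ℂ, σ.HasFrobCharpolyAt v P → ‖(P.map (ι.symm : ℂ →+* PadicAlgCl 7)).coeff 2 + (a v.residueCard 1 : PadicAlgCl 7)‖ ≤ (1 / 7 : ℝ) ^ s ∧ ‖(P.map (ι.symm : ℂ →+* PadicAlgCl 7)).coeff 1 - (v.residueCard : PadicAlgCl 7) * (a v.residueCard 2 : PadicAlgCl 7)‖ ≤ (1 / 7 : ℝ) ^ s ∧ ‖(P.map (ι.symm : ℂ →+* PadicAlgCl 7)).coeff 0 + (v.residueCard : PadicAlgCl 7) ^ 3 * (ε (ZMod.unitOfCoprime v.residueCard hv) : PadicAlgCl 7)‖ ≤ (1 / 7 : ℝ) ^ s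

/-- The crux unfolded over the vocabulary (definitional). [folklore] -/
theorem septadicTorsionOccurrence_iff :
    SeptadicTorsionOccurrence ↔
      ∀ [Fact (Nat.Prime 7)] (ι : PadicAlgCl 7 ≃+* ℂ) (σ : FramedGaloisRep ℚ ℂ 3),
        Nonempty (↥σ.toMonoidHom.range ≃* GL (Fin 3) (ZMod 2)) → (∀ (φ : ℚ →+* ℝ) (c : Field.absoluteGaloisGroup ℚ), Literature.NumberTheory.GaloisRepresentations.IsComplexConjugation φ c → σ c ≠ 1) → DoorData ι σ → CruxConclusion ι σ :=
  Iff.rfl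

/-- **The mirabolic Hecke element `D(q) = diag(1, 1, q) ∈ GL₃(ℚ)`** (`q` a prime not dividing the
level).  Its double coset `Γ₁(M) D(q) Γ₁(M)` has determinant `q`, elementary divisors `(1,1,q)` and last
row `≡ (0,0,q) (mod M)`, exactly like `E(q,1) γ_{q⁻¹}⁻¹`; hence `T_{D(q)} = T(q,1) ∘ ⟨q⟩⁻¹` on
`H^i(Γ₁(M), A)` for every `M` with `q ∤ M` — a LEVEL-UNIFORM rational avatar of the twisted Hecke
operator, used to carry the nebentype through the `7`-power tower (the diamond representatives
`γ_d ∈ Γ₀(M)` themselves depend on `M`). [folklore] -/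
def mirabolicElt (q : ℕ) : GL (Fin 3) ℚ :=
  SLn.diagGL 3 (fun j : Fin 3 => if j.val < 2 then 1 else SLn.natUnit q)

/-- **`(A, θ)` is an `𝒪/7^s`-valued point of the mirabolic Hecke algebra of `H^i(Γ₁(M) ⊂ SL₃(ℤ), 𝒪/7^s)`**:
`T(ℓ,k) ↦ A(ℓ,k)`, `T_{D(q)} ↦ θ(q)·A(q,1)` (`ℓ, q ∤ M` prime, `k ≤ 3`) kills every non-commutative
polynomial relation among these operators (Mathlib `FreeAlgebra.lift`, as in the crux). [folklore] -/
def IsMirabolicHeckePoint [Fact (Nat.Prime 7)] (s M i : ℕ) (A : ℕ → ℕ → ↥(Valued.v (R := PadicAlgCl 7)).valuationSubring) (θ : ℕ → ↥(Valued.v (R := PadicAlgCl 7)).valuationSubring) :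
    Prop :=
  (∀ F : FreeAlgebra (↥(Valued.v (R := PadicAlgCl 7)).valuationSubring ⧸ Ideal.span {((7 : ↥(Valued.v (R := PadicAlgCl 7)).valuationSubring) ^ s)}) ({lk : ℕ × ℕ // Nat.Prime lk.1 ∧ ¬ lk.1 ∣ M ∧ lk.2 ≤ 3} ⊕ {q : ℕ // Nat.Prime q ∧ ¬ q ∣ M}), FreeAlgebra.lift (↥(Valued.v (R := PadicAlgCl 7)).valuationSubring ⧸ Ideal.span {((7 : ↥(Valued.v (R := PadicAlgCl 7)).valuationSubring) ^ s)}) (Sum.elim (fun lk : {lk : ℕ × ℕ // Nat.Prime lk.1 ∧ ¬ lk.1 ∣ M ∧ lk.2 ≤ 3} => Literature.NumberTheory.Automorphic.SLn.heckeT 3 (Literature.NumberTheory.Automorphic.SLn.Gamma1 3 M) (↥(Valued.v (R := PadicAlgCl 7)).valuationSubring ⧸ Ideal.span {((7 : ↥(Valued.v (R := PadicAlgCl 7)).valuationSubring) ^ s)}) i lk.1.1 lk.1.2) (fun q : {q : ℕ // Nat.Prime q ∧ ¬ q ∣ M} => Literature.NumberTheory.Automorphic.SLn.heckeOp 3 (Literature.NumberTheory.Automorphic.SLn.Gamma1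 3 M) (↥(Valued.v (R := PadicAlgCl 7)).valuationSubring ⧸ Ideal.span {((7 : ↥(Valued.v (R := PadicAlgCl 7)).valuationSubring) ^ s)}) i (Literature.NumberTheory.Automorphic.SLn.diagGL 3 (fun j : Fin 3 => if j.val < 2 then 1 else Literature.NumberTheory.Automorphic.SLn.natUnit q.1)))) F = 0 → FreeAlgebra.lift (↥(Valued.v (R := PadicAlgCl 7)).valuationSubring ⧸ Ideal.span {((7 : ↥(Valued.v (R := PadicAlgCl 7)).valuationSubring) ^ s)}) (Sum.elim (fun lk : {lk : ℕ × ℕ // Nat.Prime lk.1 ∧ ¬ lk.1 ∣ M ∧ lk.2 ≤ 3} => Ideal.Quotient.mk (Ideal.span {((7 : ↥(Valued.v (R := PadicAlgCl 7)).valuationSubring) ^ s)}) (A lk.1.1 lk.1.2)) (fun q : {q : ℕ // Nat.Prime q ∧ ¬ q ∣ M} => Ideal.Quotient.mk (Ideal.span {((7 : ↥(Valued.v (R := PadicAlgCl 7)).valuationSubring) ^ s)}) (θ q.1 * A q.1 1))) F = 0)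

/-- **`ι⁻¹σ` is an `𝒪`-point of the mirabolic big `7`-adic Hecke algebra** (the intermediate statement
`C⁺` of the line, keyed to `(ι, σ)`): a tame level `N₀ > 0`, `7`-adic integers `A(ℓ,k)` (UNIFORM in the
depth), `η` (nebentype on primes) and `θ = η⁻¹`, with EXACT Frobenius identities
`charpoly ι⁻¹σ(Frob_ℓ) = X³ − A(ℓ,1)X² + ℓA(ℓ,2)X − ℓ³η(ℓ)` and unramifiedness at every `ℓ ∤ 7N₀`, and,
for every depth `s ≥ 1`, a level `Γ₁(N₀7^r)`, `r ≥ s`, and a degree `i` where `(A, θ)` is a mirabolic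
Hecke point modulo `7^s`. [folklore] -/
def KleinSpfPoint [Fact (Nat.Prime 7)] (ι : PadicAlgCl 7 ≃+* ℂ) (σ : FramedGaloisRep ℚ ℂ 3) : Prop :=
  ∃ (N₀ : ℕ) (A : ℕ → ℕ → ↥(Valued.v (R := PadicAlgCl 7)).valuationSubring) (η θ : ℕ → ↥(Valued.v (R := PadicAlgCl 7)).valuationSubring), 0 < N₀ ∧ (∀ q : ℕ, Nat.Prime q → ¬ q ∣ N₀ * 7 → θ q * η q = 1) ∧ (∀ (v : IsDedekindDomain.HeightOneSpectrum (NumberField.RingOfIntegers ℚ)), Nat.Coprime v.residueCard (N₀ * 7) → σ.IsUnramifiedAt v ∧ ∀ P : Polynomial ℂ, σ.HasFrobCharpolyAt v P → (P.map (ι.symm : ℂ →+* PadicAlgCl 7)).coeff 2 = -(A v.residueCard 1 : PadicAlgCl 7) ∧ (P.map (ι.symm : ℂ →+* PadicAlgCl 7)).coeff 1 = (v.residueCard : PadicAlgCl 7) * (A v.residueCard 2 : PadicAlgCl 7) ∧ (P.map (ι.symm : ℂ →+* PadicAlgCl 7)).coeff 0 = -((v.residueCard : PadicAlgCl 7) ^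 3 * (η v.residueCard : PadicAlgCl 7))) ∧ ∀ s : ℕ, 1 ≤ s → ∃ r i : ℕ, s ≤ r ∧ (∀ F : FreeAlgebra (↥(Valued.v (R := PadicAlgCl 7)).valuationSubring ⧸ Ideal.span {((7 : ↥(Valued.v (R := PadicAlgCl 7)).valuationSubring) ^ s)}) ({lk : ℕ × ℕ // Nat.Prime lk.1 ∧ ¬ lk.1 ∣ (N₀ * 7 ^ r) ∧ lk.2 ≤ 3} ⊕ {q : ℕ // Nat.Prime q ∧ ¬ q ∣ (N₀ * 7 ^ r)}), FreeAlgebra.lift (↥(Valued.v (R := PadicAlgCl 7)).valuationSubring ⧸ Ideal.span {((7 : ↥(Valued.v (R := PadicAlgCl 7)).valuationSubring) ^ s)}) (Sum.elim (fun lk : {lk : ℕ × ℕ // Nat.Prime lk.1 ∧ ¬ lk.1 ∣ (N₀ * 7 ^ r) ∧ lk.2 ≤ 3} => Literature.NumberTheory.Automorphic.SLn.heckeT 3 (Literature.NumberTheory.Automorphic.SLn.Gamma1 3 (N₀ * 7 ^ r)) (↥(Valued.v (R := PadicAlgCl 7)).valuationSubring ⧸ Ideal.span {((7 : ↥(Valued.v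 (R := PadicAlgCl 7)).valuationSubring) ^ s)}) i lk.1.1 lk.1.2) (fun q : {q : ℕ // Nat.Prime q ∧ ¬ q ∣ (N₀ * 7 ^ r)} => Literature.NumberTheory.Automorphic.SLn.heckeOp 3 (Literature.NumberTheory.Automorphic.SLn.Gamma1 3 (N₀ * 7 ^ r)) (↥(Valued.v (R := PadicAlgCl 7)).valuationSubring ⧸ Ideal.span {((7 : ↥(Valued.v (R := PadicAlgCl 7)).valuationSubring) ^ s)}) i (Literature.NumberTheory.Automorphic.SLn.diagGL 3 (fun j : Fin 3 => if j.val < 2 then 1 else Literature.NumberTheory.Automorphic.SLn.natUnit q.1)))) F = 0 → FreeAlgebra.lift (↥(Valued.v (R := PadicAlgCl 7)).valuationSubring ⧸ Ideal.span {((7 : ↥(Valued.v (R := PadicAlgCl 7)).valuationSubring) ^ s)}) (Sum.elim (fun lk : {lk : ℕ × ℕ // Nat.Prime lk.1 ∧ ¬ lk.1 ∣ (N₀ * 7 ^ r) ∧ lk.2 ≤ 3} => Ideal.Quotient.mk (Ideal.span {((7 : ↥(Valued.v (R := PadicAlgCl 7)).valuationSubring) ^ s)}) (A lk.1.1 lk.1.2))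 (fun q : {q : ℕ // Nat.Prime q ∧ ¬ q ∣ (N₀ * 7 ^ r)} => Ideal.Quotient.mk (Ideal.span {((7 : ↥(Valued.v (R := PadicAlgCl 7)).valuationSubring) ^ s)}) (θ q.1 * A q.1 1))) F = 0)

/-! ## 1. The two stubs -/

/-- **STUB 1 — big `R_σ̄ = 𝕋_𝔪` for `GL₃/ℚ` at the Klein residual point, on `ℚ̄₇`-points (the ENGINE).**
For `ι : ℚ̄₇ ≃ ℂ` and an odd Klein-image `σ : Γ_ℚ → GL₃(ℂ)` whose residual eigensystem occurs in
`H^i(Γ₁(N) ⊂ SL₃(ℤ), 𝔽̄₇)` (the Door data `(N, i, ā, ε̄)`): EVERY continuous `ρ : Γ_ℚ → GL₃(ℚ̄₇)`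
unramified at the places prime to `N` with Frobenius polynomials congruent modulo `𝔪_{ℚ̄₇}` to the
residual eigensystem (`‖·‖ < 1`, the Door's three congruences with `ρ` in place of `ι⁻¹σ`; so
`ρ̄ ≅ σ̄ ≅ L(2) = Ad⁰ρ̄_g`, absolutely irreducible) is an `𝒪`-point of the mirabolic big `7`-adic Hecke
algebra of some tame level `N₀`, `N ∣ N₀`: exact identities
`charpoly ρ(Frob_ℓ) = X³ − A(ℓ,1)X² + ℓA(ℓ,2)X − ℓ³η(ℓ)` (`ℓ ∤ 7N₀`), `θη = 1` on such primes, and for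
every `s ≥ 1` a level `Γ₁(N₀7^r)`, `r ≥ s`, and a degree `i'` at which `T(ℓ,k) ↦ A(ℓ,k)`,
`T_{D(q)} ↦ θ(q)A(q,1)` (`D(q) = diag(1,1,q)`, operator `T(q,1)⟨q⟩⁻¹`) kills every relation on
`H^{i'}(Γ₁(N₀7^r), 𝒪/7^s)`.
This is the reduced, `𝒪`-point form of `R_{σ̄,S} ≅ 𝕋(Kᵖ)_𝔪` for the completed cohomology of `GL₃/ℚ`
(no condition at `7`; Calegari–Emerton / Hansen Conj. 1.2.3 for the point `x_σ`), expected from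
Calegari–Geraghty / Gee–Newton patching of completed homology in degrees `[q₀, q₀ + l₀] = [2, 3]`
(`l₀ = 1`) — conditional in print, and every patching argument needs an adequacy substitute here:
`im σ̄ = PSL₂(7) ↷ L(2)` has `H¹(SL₂(𝔽₇), L(4)) ≠ 0` (Cline–Parshall–Scott), so the `H¹`-clause fails at
the only usable prime (Thorne-type auxiliary prime, named in the route).  Why it might fail: exactly
the crux's `why it might fail` (no big `R = 𝕋` theorem in positive defect at a non-adequate prime; even
the `s = 1` tangent direction of `x_σ` is unexhibited), plus the single-piece / torsion-newvector
reading (b) (refuter flags F-a, F-b).  Size XL (open problem).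
[cite: CalegariGeraghty2017, §1, Conj. A–B] [cite: GeeNewton2020, Thm. 1.3] [cite: HansenUniversalEigenvarieties2017, Conj. 1.2.3]
[cite: Scholze2015, Cor. V.4.2] [cite: Thorne2012, Thm. 7.1] [cite: CalegariEmerton2011, §8] -/
theorem stub_liftsAreSpfPoints :
    ∀ [Fact (Nat.Prime 7)] (ι : PadicAlgCl 7 ≃+* ℂ) (σ : Literature.NumberTheory.GaloisRepresentations.FramedGaloisRep ℚ ℂ 3), Nonempty (↥σ.toMonoidHom.range ≃* GL (Fin 3) (ZMod 2)) → (∀ (φ : ℚ →+* ℝ) (c : Field.absoluteGaloisGroup ℚ), Literature.NumberTheory.GaloisRepresentations.IsComplexConjugation φ c → σ c ≠ 1) → ∀ (N i : ℕ) (a : ℕ → ℕ → ↥(Valued.v (R := PadicAlgCl 7)).valuationSubring) (ε : (ZMod N)ˣ → ↥(Valued.v (R := PadicAlgCl 7)).valuationSubring), 0 < N → Literature.NumberTheory.Automorphic.TorsionHeckeEigensystem.Occurs 3 N (IsLocalRing.ResidueField ↥(Valued.v (R := PadicAlgCl 7)).valuationSubring) i ∅ (fun ℓ k => IsLocalRing.residue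 ↥(Valued.v (R := PadicAlgCl 7)).valuationSubring (a ℓ k)) (fun d => IsLocalRing.residue ↥(Valued.v (R := PadicAlgCl 7)).valuationSubring (ε d)) → (∀ (v : IsDedekindDomain.HeightOneSpectrum (NumberField.RingOfIntegers ℚ)) (hv : Nat.Coprime v.residueCard N), σ.IsUnramifiedAt v ∧ ∀ P : Polynomial ℂ, σ.HasFrobCharpolyAt v P → ‖(P.map (ι.symm : ℂ →+* PadicAlgCl 7)).coeff 2 + (a v.residueCard 1 : PadicAlgCl 7)‖ < 1 ∧ ‖(P.map (ι.symm : ℂ →+* PadicAlgCl 7)).coeff 1 - (v.residueCard : PadicAlgCl 7) * (a v.residueCard 2 : PadicAlgCl 7)‖ < 1 ∧ ‖(P.map (ι.symm : ℂ →+* PadicAlgCl 7)).coeff 0 + (v.residueCard : PadicAlgCl 7) ^ 3 * (ε (ZMod.unitOfCoprime v.residueCard hv) : PadicAlgCl 7)‖ < 1) → ∀ ρ : Literature.NumberTheory.GaloisRepresentations.FramedGaloisRep ℚ (PadicAlgCl 7) 3, (∀ (v : IsDedekindDomain.HeightOneSpectrum (NumberField.RingOfIntegers ℚ)) (hv : Nat.Coprime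 v.residueCard N), ρ.IsUnramifiedAt v ∧ ∀ Q : Polynomial (PadicAlgCl 7), ρ.HasFrobCharpolyAt v Q → ‖Q.coeff 2 + (a v.residueCard 1 : PadicAlgCl 7)‖ < 1 ∧ ‖Q.coeff 1 - (v.residueCard : PadicAlgCl 7) * (a v.residueCard 2 : PadicAlgCl 7)‖ < 1 ∧ ‖Q.coeff 0 + (v.residueCard : PadicAlgCl 7) ^ 3 * (ε (ZMod.unitOfCoprime v.residueCard hv) : PadicAlgCl 7)‖ < 1) → ∃ (N₀ : ℕ) (A : ℕ → ℕ → ↥(Valued.v (R := PadicAlgCl 7)).valuationSubring) (η θ : ℕ → ↥(Valued.v (R := PadicAlgCl 7)).valuationSubring), 0 < N₀ ∧ N ∣ N₀ ∧ (∀ q : ℕ, Nat.Prime q → ¬ q ∣ N₀ * 7 → θ q * η q = 1) ∧ (∀ (v : IsDedekindDomain.HeightOneSpectrum (NumberField.RingOfIntegers ℚ)), Nat.Coprime v.residueCard (N₀ * 7) → ∀ Q : Polynomial (PadicAlgCl 7), ρ.HasFrobCharpolyAt v Q → Q.coeff 2 = -(A v.residueCard 1 : PadicAlgCl 7) ∧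 Q.coeff 1 = (v.residueCard : PadicAlgCl 7) * (A v.residueCard 2 : PadicAlgCl 7) ∧ Q.coeff 0 = -((v.residueCard : PadicAlgCl 7) ^ 3 * (η v.residueCard : PadicAlgCl 7))) ∧ ∀ s : ℕ, 1 ≤ s → ∃ r i : ℕ, s ≤ r ∧ (∀ F : FreeAlgebra (↥(Valued.v (R := PadicAlgCl 7)).valuationSubring ⧸ Ideal.span {((7 : ↥(Valued.v (R := PadicAlgCl 7)).valuationSubring) ^ s)}) ({lk : ℕ × ℕ // Nat.Prime lk.1 ∧ ¬ lk.1 ∣ (N₀ * 7 ^ r) ∧ lk.2 ≤ 3} ⊕ {q : ℕ // Nat.Prime q ∧ ¬ q ∣ (N₀ * 7 ^ r)}), FreeAlgebra.lift (↥(Valued.v (R := PadicAlgCl 7)).valuationSubring ⧸ Ideal.span {((7 : ↥(Valued.v (R := PadicAlgCl 7)).valuationSubring) ^ s)}) (Sum.elim (fun lk : {lk : ℕ × ℕ // Nat.Prime lk.1 ∧ ¬ lk.1 ∣ (N₀ * 7 ^ r) ∧ lk.2 ≤ 3} => Literature.NumberTheory.Automorphic.SLn.heckeT 3 (Literature.NumberTheory.Automorphic.SLn.Gamma1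 3 (N₀ * 7 ^ r)) (↥(Valued.v (R := PadicAlgCl 7)).valuationSubring ⧸ Ideal.span {((7 : ↥(Valued.v (R := PadicAlgCl 7)).valuationSubring) ^ s)}) i lk.1.1 lk.1.2) (fun q : {q : ℕ // Nat.Prime q ∧ ¬ q ∣ (N₀ * 7 ^ r)} => Literature.NumberTheory.Automorphic.SLn.heckeOp 3 (Literature.NumberTheory.Automorphic.SLn.Gamma1 3 (N₀ * 7 ^ r)) (↥(Valued.v (R := PadicAlgCl 7)).valuationSubring ⧸ Ideal.span {((7 : ↥(Valued.v (R := PadicAlgCl 7)).valuationSubring) ^ s)}) i (Literature.NumberTheory.Automorphic.SLn.diagGL 3 (fun j : Fin 3 => if j.val < 2 then 1 else Literature.NumberTheory.Automorphic.SLn.natUnit q.1)))) F = 0 → FreeAlgebra.lift (↥(Valued.v (R := PadicAlgCl 7)).valuationSubring ⧸ Ideal.span {((7 : ↥(Valued.v (R := PadicAlgCl 7)).valuationSubring) ^ s)}) (Sum.elim (fun lk : {lk : ℕ × ℕ // Nat.Prime lk.1 ∧ ¬ lk.1 ∣ (N₀ * 7 ^ r) ∧ lk.2 ≤ 3} =>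 Ideal.Quotient.mk (Ideal.span {((7 : ↥(Valued.v (R := PadicAlgCl 7)).valuationSubring) ^ s)}) (A lk.1.1 lk.1.2)) (fun q : {q : ℕ // Nat.Prime q ∧ ¬ q ∣ (N₀ * 7 ^ r)} => Ideal.Quotient.mk (Ideal.span {((7 : ↥(Valued.v (R := PadicAlgCl 7)).valuationSubring) ^ s)}) (θ q.1 * A q.1 1))) F = 0) := by
  sorry

/-- **STUB 2 — the mirabolic readout: from the Spf-point to single-piece torsion occurrence WITH
diamonds (the crux's conclusion).**  For an odd Klein-image `σ` and `ι : ℚ̄₇ ≃ ℂ`: if `ι⁻¹σ` is an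
`𝒪`-point of the mirabolic big `7`-adic Hecke algebra (`KleinSpfPoint`, written out), then for every
`s ≥ 1` the eigensystem of `ι⁻¹σ` modulo `7^s` is a point of the Hecke algebra generated by the
`T(ℓ,k)` AND the diamond operators `⟨d⟩` of some `H^i(Γ₁(N_s), 𝒪/7^s)` with the crux's congruences
(take `N_s = N₀7^r`).  Proof plan: commutativity of `T(ℓ,k)`, `T_{D(q)}`, `⟨d⟩` on `H^i(Γ₁(M), ·)`;
`T_{D(q)} = T(q,1)⟨q⟩⁻¹` (double-coset bookkeeping, strong approximation for `SL₃`); localise the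
finite-level `T ⊕ D` algebra at the maximal ideal under the point (`𝒪/7^s` is local); Chebotarev in
`K(ζ_{N_s})/ℚ` with `K ∩ ℚ(ζ_{N_s}) = ℚ` (`Gal(K/ℚ) ≅ GL₃(𝔽₂)` simple non-abelian) gives in every class
`d mod N_s` a prime `q` with `σ(Frob_q) = 1`, `A(q,1) = 3 ∈ 𝒪ˣ`, so `⟨q⟩ = T(q,1)·T_{D(q)}⁻¹…` lies in
the localisation and the point extends uniquely to the diamonds with `ε = η mod 7^s` (a character of
`(ℤ/N₀7^r)ˣ` as `r ≥ s`; `det σ = 1` gives `η(q) = q⁻³`); the congruences `≤ 7^{-s}` are then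
equalities.  Why it might fail: only through the normalisation bookkeeping (`T_{D(q)} = T(q,1)⟨q⟩^{∓1}`:
the opposite sign is repaired by `θ ↦ η`), or if single-piece multiplicativity of the diamonds on
`H^i(Γ₁(M), 𝒪/7^s)` needed more than commutativity (it does not: `⟨d⟩⟨d'⟩ = ⟨dd'⟩` as double cosets
of the normaliser).  Size L (Hecke-algebra commutative algebra + Chebotarev; all inputs in print, the
double-coset identities not yet in the tree).
[cite: AshGunnellsMcconnell2011, §3, Def. 4] [cite: DiamondShurman2005, §5.2, Prop. 5.2.2] [cite: CalegariEmerton2011, §8]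
[cite: Neukirch1999, Ch. VII Thm. 13.4 (Chebotarev)] -/
theorem stub_mirabolicReadout :
    ∀ [Fact (Nat.Prime 7)] (ι : PadicAlgCl 7 ≃+* ℂ) (σ : Literature.NumberTheory.GaloisRepresentations.FramedGaloisRep ℚ ℂ 3), Nonempty (↥σ.toMonoidHom.range ≃* GL (Fin 3) (ZMod 2)) → (∀ (φ : ℚ →+* ℝ) (c : Field.absoluteGaloisGroup ℚ), Literature.NumberTheory.GaloisRepresentations.IsComplexConjugation φ c → σ c ≠ 1) → (∃ (N₀ : ℕ) (A : ℕ → ℕ → ↥(Valued.v (R := PadicAlgCl 7)).valuationSubring) (η θ : ℕ → ↥(Valued.v (R := PadicAlgCl 7)).valuationSubring), 0 < N₀ ∧ (∀ q : ℕ, Nat.Prime q → ¬ q ∣ N₀ * 7 → θ q * η q = 1) ∧ (∀ (v : IsDedekindDomain.HeightOneSpectrum (NumberField.RingOfIntegers ℚ)), Nat.Coprime v.residueCard (N₀ * 7) → σ.IsUnramifiedAt v ∧ ∀ P : Polynomial ℂ, σ.HasFrobCharpolyAt v P → (P.map (ι.symm : ℂ →+* PadicAlgCl 7)).coeff 2 =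 -(A v.residueCard 1 : PadicAlgCl 7) ∧ (P.map (ι.symm : ℂ →+* PadicAlgCl 7)).coeff 1 = (v.residueCard : PadicAlgCl 7) * (A v.residueCard 2 : PadicAlgCl 7) ∧ (P.map (ι.symm : ℂ →+* PadicAlgCl 7)).coeff 0 = -((v.residueCard : PadicAlgCl 7) ^ 3 * (η v.residueCard : PadicAlgCl 7))) ∧ ∀ s : ℕ, 1 ≤ s → ∃ r i : ℕ, s ≤ r ∧ (∀ F : FreeAlgebra (↥(Valued.v (R := PadicAlgCl 7)).valuationSubring ⧸ Ideal.span {((7 : ↥(Valued.v (R := PadicAlgCl 7)).valuationSubring) ^ s)}) ({lk : ℕ × ℕ // Nat.Prime lk.1 ∧ ¬ lk.1 ∣ (N₀ * 7 ^ r) ∧ lk.2 ≤ 3} ⊕ {q : ℕ // Nat.Prime q ∧ ¬ q ∣ (N₀ * 7 ^ r)}), FreeAlgebra.lift (↥(Valued.v (R := PadicAlgCl 7)).valuationSubring ⧸ Ideal.span {((7 : ↥(Valued.v (R := PadicAlgCl 7)).valuationSubring) ^ s)}) (Sum.elim (fun lk : {lk : ℕ × ℕ // Nat.Prime lk.1 ∧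 ¬ lk.1 ∣ (N₀ * 7 ^ r) ∧ lk.2 ≤ 3} => Literature.NumberTheory.Automorphic.SLn.heckeT 3 (Literature.NumberTheory.Automorphic.SLn.Gamma1 3 (N₀ * 7 ^ r)) (↥(Valued.v (R := PadicAlgCl 7)).valuationSubring ⧸ Ideal.span {((7 : ↥(Valued.v (R := PadicAlgCl 7)).valuationSubring) ^ s)}) i lk.1.1 lk.1.2) (fun q : {q : ℕ // Nat.Prime q ∧ ¬ q ∣ (N₀ * 7 ^ r)} => Literature.NumberTheory.Automorphic.SLn.heckeOp 3 (Literature.NumberTheory.Automorphic.SLn.Gamma1 3 (N₀ * 7 ^ r)) (↥(Valued.v (R := PadicAlgCl 7)).valuationSubring ⧸ Ideal.span {((7 : ↥(Valued.v (R := PadicAlgCl 7)).valuationSubring) ^ s)}) i (Literature.NumberTheory.Automorphic.SLn.diagGL 3 (fun j : Fin 3 => if j.val < 2 then 1 else Literature.NumberTheory.Automorphic.SLn.natUnit q.1)))) F = 0 → FreeAlgebra.lift (↥(Valued.v (R := PadicAlgCl 7)).valuationSubring ⧸ Ideal.span {((7 : ↥(Valued.v (R := PadicAlgCl 7)).valuationSubring)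 ^ s)}) (Sum.elim (fun lk : {lk : ℕ × ℕ // Nat.Prime lk.1 ∧ ¬ lk.1 ∣ (N₀ * 7 ^ r) ∧ lk.2 ≤ 3} => Ideal.Quotient.mk (Ideal.span {((7 : ↥(Valued.v (R := PadicAlgCl 7)).valuationSubring) ^ s)}) (A lk.1.1 lk.1.2)) (fun q : {q : ℕ // Nat.Prime q ∧ ¬ q ∣ (N₀ * 7 ^ r)} => Ideal.Quotient.mk (Ideal.span {((7 : ↥(Valued.v (R := PadicAlgCl 7)).valuationSubring) ^ s)}) (θ q.1 * A q.1 1))) F = 0)) → ∀ s : ℕ, 1 ≤ s → ∃ (N i : ℕ) (a : ℕ → ℕ → ↥(Valued.v (R := PadicAlgCl 7)).valuationSubring) (ε : (ZMod N)ˣ → ↥(Valued.v (R := PadicAlgCl 7)).valuationSubring), 0 < N ∧ (∀ F : FreeAlgebra (↥(Valued.v (R := PadicAlgCl 7)).valuationSubring ⧸ Ideal.span {((7 : ↥(Valued.v (R := PadicAlgCl 7)).valuationSubring) ^ s)}) ({lk : ℕ × ℕ // Nat.Prime lk.1 ∧ ¬ lk.1 ∣ N ∧ lk.2 ≤ 3}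 ⊕ (ZMod N)ˣ), FreeAlgebra.lift (↥(Valued.v (R := PadicAlgCl 7)).valuationSubring ⧸ Ideal.span {((7 : ↥(Valued.v (R := PadicAlgCl 7)).valuationSubring) ^ s)}) (Sum.elim (fun lk : {lk : ℕ × ℕ // Nat.Prime lk.1 ∧ ¬ lk.1 ∣ N ∧ lk.2 ≤ 3} => Literature.NumberTheory.Automorphic.SLn.heckeT 3 (Literature.NumberTheory.Automorphic.SLn.Gamma1 3 N) (↥(Valued.v (R := PadicAlgCl 7)).valuationSubring ⧸ Ideal.span {((7 : ↥(Valued.v (R := PadicAlgCl 7)).valuationSubring) ^ s)}) i lk.1.1 lk.1.2) (fun d : (ZMod N)ˣ => Literature.NumberTheory.Automorphic.SLn.diamondOp 3 N (↥(Valued.v (R := PadicAlgCl 7)).valuationSubring ⧸ Ideal.span {((7 : ↥(Valued.v (R := PadicAlgCl 7)).valuationSubring) ^ s)}) i (d : ZMod N))) F = 0 → FreeAlgebra.lift (↥(Valued.v (R := PadicAlgCl 7)).valuationSubring ⧸ Ideal.span {((7 : ↥(Valued.v (R := PadicAlgCl 7)).valuationSubring) ^ s)}) (Sum.elim (fun lk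 : {lk : ℕ × ℕ // Nat.Prime lk.1 ∧ ¬ lk.1 ∣ N ∧ lk.2 ≤ 3} => Ideal.Quotient.mk (Ideal.span {((7 : ↥(Valued.v (R := PadicAlgCl 7)).valuationSubring) ^ s)}) (a lk.1.1 lk.1.2)) (fun d : (ZMod N)ˣ => Ideal.Quotient.mk (Ideal.span {((7 : ↥(Valued.v (R := PadicAlgCl 7)).valuationSubring) ^ s)}) (ε d))) F = 0) ∧ ∀ (v : IsDedekindDomain.HeightOneSpectrum (NumberField.RingOfIntegers ℚ)) (hv : Nat.Coprime v.residueCard N), σ.IsUnramifiedAt v ∧ ∀ P : Polynomial ℂ, σ.HasFrobCharpolyAt v P → ‖(P.map (ι.symm : ℂ →+* PadicAlgCl 7)).coeff 2 + (a v.residueCard 1 : PadicAlgCl 7)‖ ≤ (1 / 7 : ℝ) ^ s ∧ ‖(P.map (ι.symm : ℂ →+* PadicAlgCl 7)).coeff 1 - (v.residueCard : PadicAlgCl 7) * (a v.residueCard 2 : PadicAlgCl 7)‖ ≤ (1 / 7 : ℝ) ^ s ∧ ‖(P.map (ι.symm : ℂ →+* PadicAlgCl 7)).coeff 0 + (v.residueCard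 : PadicAlgCl 7) ^ 3 * (ε (ZMod.unitOfCoprime v.residueCard hv) : PadicAlgCl 7)‖ ≤ (1 / 7 : ℝ) ^ s := by
  sorry

/-! ## 2. The stub statements as named `Prop`s (literally their types) -/

namespace _Goal

/-- The statement of `stub_liftsAreSpfPoints`, as a named `Prop` (literally its type). [folklore] -/
def stub_liftsAreSpfPoints : Prop :=
  type_of% @Summit.Langlands.Langlands.Cruxes.SeptadicTorsionOccurrence.Birth.stub_liftsAreSpfPoints

/-- The statement of `stub_mirabolicReadout`, as a named `Prop` (literally its type). [folklore] -/
def stub_mirabolicReadout : Prop :=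
  type_of% @Summit.Langlands.Langlands.Cruxes.SeptadicTorsionOccurrence.Birth.stub_mirabolicReadout

end _Goal

/-- The readout stub over this file's vocabulary (definitional). [folklore] -/
theorem goal_mirabolicReadout_iff :
    _Goal.stub_mirabolicReadout ↔
      ∀ [Fact (Nat.Prime 7)] (ι : PadicAlgCl 7 ≃+* ℂ) (σ : FramedGaloisRep ℚ ℂ 3),
        Nonempty (↥σ.toMonoidHom.range ≃* GL (Fin 3) (ZMod 2)) → (∀ (φ : ℚ →+* ℝ) (c : Field.absoluteGaloisGroup ℚ), Literature.NumberTheory.GaloisRepresentations.IsComplexConjugation φ c → σ c ≠ 1) → KleinSpfPoint ι σ → CruxConclusion ι σ :=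
  Iff.rfl

/-! ## 3. The `7`-adic avatar of a finite-image complex representation (real proof) -/

/-- A group homomorphism out of a topological group whose kernel is open is continuous (it is locally
constant).  Local copy (the tree has namesakes in unrelated files). [folklore] -/
private theorem continuous_of_isOpen_ker_aux {G H : Type*} [Group G] [TopologicalSpace G]
    [IsTopologicalGroup G] [Group H] [TopologicalSpace H] [ContinuousMul H] (f : G →* H)
    (hf : IsOpen (f.ker : Set G)) : Continuous f := by
  apply continuous_of_continuousAt_one f
  rw [ContinuousAt, map_one]
  intro U hU
  rw [Filter.mem_map]
  apply Filter.mem_of_superset (hf.mem_nhds (by simp))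
  intro g hg
  rw [SetLike.mem_coe, MonoidHom.mem_ker] at hg
  rw [Set.mem_preimage, hg]
  exact mem_of_mem_nhds hU

/-- **The `7`-adic avatar `ι⁻¹ ∘ σ` of a complex Galois representation with Klein (hence finite)
image.**  For `ι : ℚ̄₇ ≃+* ℂ` and `σ : Γ_ℚ →ₜ* GL₃(ℂ)` with `im σ ≅ GL₃(𝔽₂)`, the homomorphism
`g ↦ (σ g).map ι⁻¹ : Γ_ℚ → GL₃(ℚ̄₇)` is continuous (its kernel `ker σ` is closed of finite index, hence
open), it is unramified wherever `σ` is, and its Frobenius characteristic polynomials are those of `σ`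
transported along `ι⁻¹` (`Matrix.charpoly_map`), in both directions. [folklore] -/
theorem exists_sevenAdicAvatar [Fact (Nat.Prime 7)] (ι : PadicAlgCl 7 ≃+* ℂ)
    (σ : FramedGaloisRep ℚ ℂ 3) (hK : Nonempty (↥σ.toMonoidHom.range ≃* GL (Fin 3) (ZMod 2))) :
    ∃ ρ : FramedGaloisRep ℚ (PadicAlgCl 7) 3,
      (∀ v : HeightOneSpectrum (𝓞 ℚ), σ.IsUnramifiedAt v → ρ.IsUnramifiedAt v) ∧
      (∀ (v : HeightOneSpectrum (𝓞 ℚ)) (Q : Polynomial (PadicAlgCl 7)), ρ.HasFrobCharpolyAt v Q →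
        σ.HasFrobCharpolyAt v (Q.map (ι : PadicAlgCl 7 →+* ℂ))) ∧
      (∀ (v : HeightOneSpectrum (𝓞 ℚ)) (P : Polynomial ℂ), σ.HasFrobCharpolyAt v P →
        ρ.HasFrobCharpolyAt v (P.map (ι.symm : ℂ →+* PadicAlgCl 7))) := by
  classical
  -- (1) `ker σ` is open: closed (preimage of the closed point `1` of `M₃(ℂ)`) and of finite index
  have hcont : Continuous fun g : Field.absoluteGaloisGroup ℚ =>
      ((σ g : GL (Fin 3) ℂ) : Matrix (Fin 3) (Fin 3) ℂ) :=
    Units.continuous_val.comp (map_continuous σ)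
  have hset : ((σ.toMonoidHom.ker : Subgroup (Field.absoluteGaloisGroup ℚ)) :
      Set (Field.absoluteGaloisGroup ℚ)) =
        (fun g : Field.absoluteGaloisGroup ℚ => ((σ g : GL (Fin 3) ℂ) : Matrix (Fin 3) (Fin 3) ℂ)) ⁻¹'
          {(1 : Matrix (Fin 3) (Fin 3) ℂ)} := by
    ext g
    simp only [SetLike.mem_coe, MonoidHom.mem_ker, Set.mem_preimage, Set.mem_singleton_iff]
    change σ g = 1 ↔ ((σ g : GL (Fin 3) ℂ) : Matrix (Fin 3) (Fin 3) ℂ) = 1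
    exact Units.val_eq_one.symm
  have hclosed : IsClosed ((σ.toMonoidHom.ker : Subgroup (Field.absoluteGaloisGroup ℚ)) :
      Set (Field.absoluteGaloisGroup ℚ)) := by
    rw [hset]
    exact isClosed_singleton.preimage hcont
  haveI hfi : σ.toMonoidHom.ker.FiniteIndex := by
    obtain ⟨e⟩ := hK
    haveI : Finite (GL (Fin 3) (ZMod 2)) := Finite.of_injective _ Units.val_injective
    haveI : Finite ↥σ.toMonoidHom.range := Finite.of_equiv _ e.symm.toEquiv
    haveI : Finite (Field.absoluteGaloisGroup ℚ ⧸ σ.toMonoidHom.ker) :=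
      Finite.of_equiv _ (QuotientGroup.quotientKerEquivRange σ.toMonoidHom).symm.toEquiv
    exact Subgroup.finiteIndex_of_finite_quotient
  have hopen : IsOpen ((σ.toMonoidHom.ker : Subgroup (Field.absoluteGaloisGroup ℚ)) :
      Set (Field.absoluteGaloisGroup ℚ)) :=
    Subgroup.isOpen_of_isClosed_of_finiteIndex _ hclosed
  -- (2) the transported homomorphism and its continuity
  set f : GL (Fin 3) ℂ →* GL (Fin 3) (PadicAlgCl 7) :=
    Matrix.GeneralLinearGroup.map (ι.symm : ℂ →+* PadicAlgCl 7) with hf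
  set ρ₀ : Field.absoluteGaloisGroup ℚ →* GL (Fin 3) (PadicAlgCl 7) := f.comp σ.toMonoidHom with hρ₀
  have hρ₀_apply : ∀ g, ρ₀ g = f (σ g) := fun g => rfl
  have hρ₀_open : IsOpen ((ρ₀.ker : Subgroup (Field.absoluteGaloisGroup ℚ)) :
      Set (Field.absoluteGaloisGroup ℚ)) := by
    refine Subgroup.isOpen_mono ?_ hopen
    intro g hg
    rw [MonoidHom.mem_ker] at hg ⊢
    rw [hρ₀_apply, show σ g = 1 from hg, map_one]
  let ρ : FramedGaloisRep ℚ (PadicAlgCl 7) 3 := ⟨ρ₀, continuous_of_isOpen_ker_aux ρ₀ hρ₀_open⟩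
  have hρ_apply : ∀ g, ρ g = f (σ g) := fun g => rfl
  -- (3) characteristic polynomials transport along `ι⁻¹`
  have hmat : ∀ g : GL (Fin 3) ℂ,
      ((f g : GL (Fin 3) (PadicAlgCl 7)) : Matrix (Fin 3) (Fin 3) (PadicAlgCl 7)) =
        (g : Matrix (Fin 3) (Fin 3) ℂ).map (ι.symm : ℂ →+* PadicAlgCl 7) := by
    intro g
    ext i j
    rw [Matrix.map_apply, hf]
    exact Matrix.GeneralLinearGroup.map_apply _ i j g
  have hchar : ∀ g, FramedRep.charpoly ρ g =
      (FramedRep.charpoly σ g).map (ι.symm : ℂ →+* PadicAlgCl 7) := by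
    intro g
    simp only [FramedRep.charpoly]
    rw [hρ_apply, hmat, Matrix.charpoly_map]
  have hmapmap : ∀ P : Polynomial ℂ,
      (P.map (ι.symm : ℂ →+* PadicAlgCl 7)).map (ι : PadicAlgCl 7 →+* ℂ) = P := by
    intro P
    have hcomp : (ι : PadicAlgCl 7 →+* ℂ).comp (ι.symm : ℂ →+* PadicAlgCl 7) = RingHom.id ℂ := by
      ext x
      simp
    rw [Polynomial.map_map, hcomp, Polynomial.map_id]
  refine ⟨ρ, ?_, ?_, ?_⟩
  · intro v hv 𝔓 h𝔓 g hg
    rw [hρ_apply, hv 𝔓 h𝔓 g hg, map_one]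
  · intro v Q hQ 𝔓 h𝔓 g hg
    have h1 := hQ 𝔓 h𝔓 g hg
    rw [hchar] at h1
    rw [← h1, hmapmap]
  · intro v P hP 𝔓 h𝔓 g hg
    rw [hchar, hP 𝔓 h𝔓 g hg]

/-! ## 4. The composition (kernel-checked, no `sorry`): ENGINE on the avatar → READOUT → the crux by name -/

/-- **`SeptadicTorsionOccurrence` from the two stubs.**  Given `ι`, an odd Klein `σ` and Door data
`(N, i, ā, ε̄)`: build the `7`-adic avatar `ρ_σ = ι⁻¹σ` (`exists_sevenAdicAvatar`); it is residually
congruent to the Door data because `σ` is (transport of unramifiedness and of Frobenius polynomials,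
`(Q.map ι).map ι⁻¹ = Q`); `stub_liftsAreSpfPoints` makes it an `𝒪`-point of the mirabolic big Hecke
algebra (tame level `N₀`, `N ∣ N₀`); pulling the exact identities back to `σ` along `ι` (and
unramifiedness at `v ∤ N₀·7 ⊇` the primes of `N` from the Door) gives `KleinSpfPoint ι σ`, and
`stub_mirabolicReadout` returns the crux's conclusion.  The hypotheses are, by name, the statements of
the two stubs; the conclusion is the route decl
`Summit.Langlands.Langlands.Theses.KleinTorsionDoor.SeptadicTorsionOccurrence`. [folklore] -/
theorem SeptadicTorsionOccurrence_of (hA : _Goal.stub_liftsAreSpfPoints)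
    (hB : _Goal.stub_mirabolicReadout) :
    Summit.Langlands.Langlands.Theses.KleinTorsionDoor.SeptadicTorsionOccurrence := by
  -- the stub statements, as the Π-types they literally are
  have hEngine : type_of% @stub_liftsAreSpfPoints := hA
  have hReadout : type_of% @stub_mirabolicReadout := hB
  intro hp ι σ hK hodd hD s hs
  obtain ⟨N, i, a, ε, hN, hOcc, hFrob⟩ := hD
  -- the 7-adic avatar `ρ = ι⁻¹ ∘ σ`
  obtain ⟨ρ, hρunr, hρQ, hρP⟩ := exists_sevenAdicAvatar ι σ hK
  -- `(Q.map ι).map ι⁻¹ = Q`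
  have hmapmap : ∀ Q : Polynomial (PadicAlgCl 7),
      (Q.map (ι : PadicAlgCl 7 →+* ℂ)).map (ι.symm : ℂ →+* PadicAlgCl 7) = Q := by
    intro Q
    have hcomp : (ι.symm : ℂ →+* PadicAlgCl 7).comp (ι : PadicAlgCl 7 →+* ℂ) =
        RingHom.id (PadicAlgCl 7) := by
      ext x
      simp
    rw [Polynomial.map_map, hcomp, Polynomial.map_id]
  -- `ρ` is residually congruent to the Door data (because `σ` is)
  have hρdoor : (∀ (v : IsDedekindDomain.HeightOneSpectrum (NumberField.RingOfIntegers ℚ)) (hv : Nat.Coprime v.residueCard N), ρ.IsUnramifiedAt v ∧ ∀ Q : Polynomial (PadicAlgCl 7), ρ.HasFrobCharpolyAt v Q → ‖Q.coeff 2 + (a v.residueCard 1 : PadicAlgCl 7)‖ < 1 ∧ ‖Q.coeff 1 - (v.residueCard : PadicAlgCl 7) * (a v.residueCard 2 : PadicAlgCl 7)‖ < 1 ∧ ‖Q.coeff 0 + (v.residueCard : PadicAlgCl 7) ^ 3 * (ε (ZMod.unitOfCoprime v.residueCard hv) : PadicAlgCl 7)‖ < 1) := by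
    intro v hv
    refine ⟨hρunr v (hFrob v hv).1, fun Q hQ => ?_⟩
    have h := (hFrob v hv).2 (Q.map (ι : PadicAlgCl 7 →+* ℂ)) (hρQ v Q hQ)
    rw [hmapmap] at h
    exact h
  -- ENGINE: `ρ` is an `𝒪`-point of the mirabolic big Hecke algebra
  obtain ⟨N₀, A, η, θ, hN₀, hdvd, hθη, hexact, hHA⟩ :=
    hEngine ι σ hK hodd N i a ε hN hOcc hFrob ρ hρdoor
  -- pull the exact identities back to `σ` along `ι`, then READOUT
  refine hReadout ι σ hK hodd ⟨N₀, A, η, θ, hN₀, hθη, ?_, hHA⟩ s hs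
  intro v hv
  have hvN : Nat.Coprime v.residueCard N :=
    Nat.Coprime.coprime_dvd_right (Dvd.dvd.mul_right hdvd 7) hv
  exact ⟨(hFrob v hvN).1, fun P hP => hexact v hv _ (hρP v P hP)⟩

/-- By-name sanity check (an `example`, not a declaration of the file): the two stubs feed the
composition as they stand. -/
example : Summit.Langlands.Langlands.Theses.KleinTorsionDoor.SeptadicTorsionOccurrence :=
  SeptadicTorsionOccurrence_of stub_liftsAreSpfPoints stub_mirabolicReadout

end Summit.Langlands.Langlands.Cruxes.SeptadicTorsionOccurrence.Birth

end
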